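import Summits.CriticalPhenomena.PercolationContinuityZ3.Theorems.Transplant.SkelNegBParamsSchedA
import HarnessLib

/-!
# N1 params, chain of record `NegB`, part Col-A — the (ζ′) twin of part Col (p28xxxx) at `A := Aof κ = 20·K`: THE COLUMN VERTEX OF RECORD `NegB.colVA … y` over each
# planar cell centre of the (ζ′) cells — the (C) binders `cOf/hcF/hcQ/hcD` for the fine map `fineA … φ′`: `F (colVA y) = cen y`, `colVA y ∈ VWin F t (Q y) (rQ a y)` for
# every level `a` of `schedOfA S`, and `colVA y ∈ graphBall t (cOffA·‖y‖₁ + 1)` (`cC := cOffA = A·(ℓ_L + 21n_L + 1)`, `dC := 1`) (stmt-g16 2026-08-22; NEG-SCOPE §B.19 (ζ′))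
THE CHOICE: `colVA y` := the vertex of `hcol_fineA_at` at the least radius `NrepA (cen y) + 1`; window spans are monotone in the radius (`VWin_mono`), so the same vertex serves
every schedule level (`colQ_schedOfA`), and lies in the graph ball of radius `offNA y ≤ cOffA·‖y‖₁ + 1` (`offNA_le`).
builds on p205010 (kernel theorem, internal audit signed; external expert review pending) — nothing in this file uses p205010; NOTHING is claimed about the node
`SamePDropOfSkeletonNeg₁` (OPEN).
Lane `prim-bschramm-*`, seat `prim-bschramm-stmt` (gen 16); helper file (`--supports stmt-CriticalPhenomena-4575 --as helper`); ledger HOME/prim-bschramm-stmt/NEG-PARAMS.md.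
* `colVA` (+ `colVA_spec`), **`colVA_eq`** (`hcF`), **`colVA_mem_VWin`** (`hcQ`, any radius `≥ NrepA (cen y) + 1`), **`colVA_mem_VWin_schedOfA`**, **`colVA_mem_graphBall`** (`hcD`).
[cite: KozmaNitzan2024, §4 pp. 25–26 (the vertex over a cell centre); Lemma 12 (p. 24)] [cite: MartineauTassion2017, §4.3]
-/

noncomputable section

open scoped Classical

namespace Summit.CriticalPhenomena.PercolationContinuityZ3.Theorems.Transplant

open Literature.Probability.LatticeModels SimpleGraph
open Literature.Barriers.CriticalPhenomena (graphBall graphBall_mono)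

namespace PlanarSkeletonNeg

namespace NegB

open SkelConc (Consts)
open Neg

section Col

variable (κ : Consts) {V : Type} [DecidableEq V] [Countable V] {G : SimpleGraph V} [G.LocallyFinite] (Φ : PlanarSkeletonNeg G) (t : V)
  (p : unitInterval) (D : Skelφ.StepI.DataN V) (g f : ℕ) {φ' : V → Site 2}

/-- **THE COLUMN VERTEX OF RECORD over the cell centre `cen y` of the (ζ′) cells** (for the fine map `fineA … φ′`, `φ′` 1-Lipschitz with unit steps, under the numeric long
clause). [this work] -/
def colVA (hlip : Skelφ.Lip G φ') (hstep : Skelφ.Steps G φ') (hN : EqNumL κ Φ t p D g f) (y : Site 2) : V :=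
  Classical.choose (hcol_fineA_at κ Φ t p D g f hlip hstep hN y le_rfl)

/-- The defining property of `colVA y`. [folklore] -/
theorem colVA_spec (hlip : Skelφ.Lip G φ') (hstep : Skelφ.Steps G φ') (hN : EqNumL κ Φ t p D g f) (y : Site 2) :
    colVA κ Φ t p D g f hlip hstep hN y ∈
        Skelφ.VWin G (fineA κ Φ t p D g f φ') t ((fcellsA κ Φ t p D g f).Q y) (NrepA κ Φ t p D g f ((fcellsA κ Φ t p D g f).cen y) + 1) ∧
      fineA κ Φ t p D g f φ' (colVA κ Φ t p D g f hlip hstep hN y) = (fcellsA κ Φ t p D g f).cen y := by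
  obtain ⟨h1, h2⟩ := Classical.choose_spec (hcol_fineA_at κ Φ t p D g f hlip hstep hN y le_rfl)
  exact ⟨h1, h2⟩

/-- **`hcF`**: `F (colVA y) = cen y`. [this work] -/
theorem colVA_eq (hlip : Skelφ.Lip G φ') (hstep : Skelφ.Steps G φ') (hN : EqNumL κ Φ t p D g f) (y : Site 2) :
    fineA κ Φ t p D g f φ' (colVA κ Φ t p D g f hlip hstep hN y) = (fcellsA κ Φ t p D g f).cen y :=
  (colVA_spec κ Φ t p D g f hlip hstep hN y).2

/-- **`hcQ` at any radius** `R ≥ NrepA (cen y) + 1`: `colVA y ∈ VWin F t (Q y) R`. [this work] -/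
theorem colVA_mem_VWin (hlip : Skelφ.Lip G φ') (hstep : Skelφ.Steps G φ') (hN : EqNumL κ Φ t p D g f) (y : Site 2) {R : ℕ}
    (hR : NrepA κ Φ t p D g f ((fcellsA κ Φ t p D g f).cen y) + 1 ≤ R) :
    colVA κ Φ t p D g f hlip hstep hN y ∈ Skelφ.VWin G (fineA κ Φ t p D g f φ') t ((fcellsA κ Φ t p D g f).Q y) R :=
  Skelφ.VWin_mono subset_rfl hR (colVA_spec κ Φ t p D g f hlip hstep hN y).1

/-- **`hcQ` at the schedule of record**: `colVA y ∈ VWin F t (Q y) ((schedOfA S).rQ a y)` for every level `a` and every input block `S`. [this work] -/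
theorem colVA_mem_VWin_schedOfA (hlip : Skelφ.Lip G φ') (hstep : Skelφ.Steps G φ') (hN : EqNumL κ Φ t p D g f) (S : Skelφ.Prm.SchedIn) (a : ℕ) (y : Site 2) :
    colVA κ Φ t p D g f hlip hstep hN y ∈ Skelφ.VWin G (fineA κ Φ t p D g f φ') t ((fcellsA κ Φ t p D g f).Q y) ((schedOfA κ Φ t p D g f S).rQ a y) :=
  colVA_mem_VWin κ Φ t p D g f hlip hstep hN y (colQ_schedOfA κ Φ t p D g f S a y)

/-- **`hcD`**: `colVA y ∈ graphBall t (cOffA·(|y₀| + |y₁|) + 1)` (under `|h_L| ≤ 10·n_L`). [this work] -/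
theorem colVA_mem_graphBall (hlip : Skelφ.Lip G φ') (hstep : Skelφ.Steps G φ') (hN : EqNumL κ Φ t p D g f) (hκ : (hL κ Φ t p D g f).natAbs ≤ 10 * nL κ Φ t p D g f)
    (y : Site 2) : colVA κ Φ t p D g f hlip hstep hN y ∈ graphBall G t (cOffA κ Φ t p D g f * ((y 0).natAbs + (y 1).natAbs) + 1) := by
  have h1 := Skelφ.mem_graphBall_of_mem_VWin (colVA_spec κ Φ t p D g f hlip hstep hN y).1
  have h2 : NrepA κ Φ t p D g f ((fcellsA κ Φ t p D g f).cen y) + 1 ≤ cOffA κ Φ t p D g f * ((y 0).natAbs + (y 1).natAbs) + 1 :=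
    offNA_le κ Φ t p D g f hN hκ y
  exact graphBall_mono G t h2 h1

end Col

end NegB

end PlanarSkeletonNeg

end Summit.CriticalPhenomena.PercolationContinuityZ3.Theorems.Transplant

end
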